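import Summits.ABC.IUTFork.LDHSlotResidueShareSharp
import Mathlib.Algebra.BigOperators.Fin
import Mathlib.Tactic.Positivity
import Mathlib.Tactic.Ring
import Mathlib.Tactic.Linarith
import HarnessLib

/-!
# The fork at [IUTchIII] Corollary 3.12, L-DH level: the (Ind1) slot residue at a mixed prime, II — the EXACT value
# when the bad places over `p` are indistinguishable (one bad place over `p`: a closed formula)

Record-only PROOF file (D-0012) of the abc-iut cell (block C / W6 seat abc-iut-w6-d115, gen 2); sequel to
`LDHSlotResidueShareSharp.lean` (this seat, p434866) and abc-iut-w6-d018's `LDHSlotResidueGoodShare.lean` (p433633);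
the two-sided mixed-share SANDWICH is abc-iut-s2-p2's `Literature/IUT/LogVolume/PilotSlotResidueMixedShare.lean` (p434720)
— this file adds the case of EQUALITY. TAKES NO SIDE on [IUTchIII] Cor. 3.12 or [IUTchIV] Thm. 1.10. Sources:
Dupuy–Hilado, arXiv:2004.13228 [DupuyHilado2025] §3.3, §3.6, §4.7, §4.11–4.12; S. Mochizuki, *IUT IV* [Mochizuki2012],
proof of Thm. 1.10 Step (v) p. 27–28, Step (vi) p. 29; cell note HOME/plan/c312/STEPV-IND1-NOTE.md §4 (regime (b)).
Notation as in part I: `a_j(p) = Σ_{v|p} θ_j(v)Pr(v)`, `ω_b(p)` / `ω_g(p)` the weights of the bad / good places over `p`,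
`μ(v) = P_q(v)·ln|κ(v)|/n_v`.

WHAT IS PROVED (pilot data only, every sum finite):
* **`inner_defect_sum_eq_of_badConst`** / **`slotResidue_singleton_eq_of_badConst`** — EQUALITY in part I's sharp
  bound when `θ_j` is constant on the bad places over `p` (the least slot of an all-bad collection is the common value,
  of any other collection `0`): `slotResidue X {p} = (1/ℓ⋇)·Σ_j (1 − ω_b(p)^j)·a_j(p)` — so the sharp lower bound of
  part I / of s2-p2's `slotResidue_ge_mixedShare` is ATTAINED exactly at such primes, and the residue there is a closed
  polynomial in the bad weight;
* **`slotResidue_singleton_eq_of_unique_bad`** — exactly ONE bad place `v` over `p` (e.g. a prime of `F_mod` split into a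
  bad and a good place of a quadratic field — the configuration of STEPV-IND1-NOTE §4 and of abc-iut-S7's split witness):
  `slotResidue X {p} = (1/ℓ⋇)·Σ_j (1 − Pr(v)^j)·j²·μ(v)·Pr(v)`;
* `goodWeight_mul_le_sharp_term` — the sharp bound dominates w6-d018's good-share bound termwise (`ω_g ≤ 1 − ω_b^j`).
[cite: DupuyHilado2025, §3.3, §3.6, §4.7, §4.11, §4.12] [cite: Mochizuki2012, IUTchIV Thm. 1.10 Step (v)–(vi) p. 27–29]
[claim: Mochizuki2012, status: disputed] for every IUT quotation. No datum is constructed; typed ≠ endorsed.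
-/

noncomputable section

namespace Literature.IUT.LogVolume

open NumberField IsDedekindDomain Finset

namespace PilotData

variable {F : Type*} [Field F] [NumberField F] (X : PilotData F)

/-- `θ_j(v) ≥ 0` — `private` universe-polymorphic copy of abc-iut-c312-d1's `PilotData.slotValue_nonneg` (stated over
`F : Type`), kept local so that this file stays over `F : Type*` like its parents. [cite: DupuyHilado2025, §3.3–3.4] -/
private theorem zero_le_slotValue' (i : Fin X.lstar) (v : HeightOneSpectrum (𝓞 F)) : 0 ≤ X.slotValue i v := by
  rw [slotValue_eq_sq_mul]
  exact mul_nonneg (sq_nonneg _) (X.qPilot_mul_logNorm_div_nonneg v)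

/-! ## Equality when the bad places over `p` are indistinguishable -/

open scoped Classical in
/-- **Exact defect per `(p, j)` when `θ_j` is constant on the bad places over `p`**: the least slot of a collection is
the common bad value if all its `j+1` slots are bad and `0` otherwise, so
`Σ_{v⃗} (θ_j(v⃗(j)) − min_k θ_j(v⃗(k)))·Π_k Pr(v⃗(k)) = (1 − ω_b(p)^j)·a_j(p)`.
[cite: Mochizuki2012, IUTchIV Thm. 1.10 Step (v) p. 27–28] -/
theorem inner_defect_sum_eq_of_badConst (p : ℕ) [Fact p.Prime] (i : Fin X.lstar)
    (h : ∀ v ∈ placesOver F p, ∀ v' ∈ placesOver F p, v ∈ X.S → v' ∈ X.S →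
      X.slotValue i v = X.slotValue i v') :
    ∑ e : Fin ((i : ℕ) + 1 + 1) → placesOver F p,
        (X.slotValue i (e (Fin.last _)).1
          - Finset.univ.inf' Finset.univ_nonempty (fun k => X.slotValue i (e k).1)) *
          ∏ k, weight F (e k).1 =
      (1 - (∑ v ∈ Finset.univ.filter (fun v : placesOver F p => v.1 ∈ X.S), weight F v.1) ^ ((i : ℕ) + 1)) *
        ∑ v : placesOver F p, X.slotValue i v.1 * weight F v.1 := by
  classical
  set m : ℕ := (i : ℕ) + 1 with hm
  set w : placesOver F p → ℝ := fun v => weight F v.1 with hw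
  set b : placesOver F p → ℝ := fun v => if v.1 ∈ X.S then (1 : ℝ) else 0 with hb
  set θ : placesOver F p → ℝ := fun v => X.slotValue i v.1 with hθ
  -- `𝟙_S·θ = θ` (θ vanishes off S)
  have hθb : ∀ v : placesOver F p, b v * θ v = θ v := by
    intro v
    by_cases hv : v.1 ∈ X.S
    · simp only [hb, hv, if_true, one_mul]
    · simp only [hb, hv, if_false, zero_mul, hθ, X.slotValue_eq_zero_of_not_mem i hv]
  -- the least slot: common bad value on all-bad collections, `0` otherwise
  have hinf : ∀ e : Fin (m + 1) → placesOver F p,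
      Finset.univ.inf' Finset.univ_nonempty (fun k => X.slotValue i (e k).1) =
        (∏ j : Fin m, b (e (Fin.castSucc j))) * (b (e (Fin.last m)) * θ (e (Fin.last m))) := by
    intro e
    obtain ⟨k₀, _, hk₀⟩ := Finset.exists_mem_eq_inf' Finset.univ_nonempty (fun k => X.slotValue i (e k).1)
    by_cases hall : ∀ k : Fin (m + 1), (e k).1 ∈ X.S
    · have h1 : ∏ j : Fin m, b (e (Fin.castSucc j)) = 1 :=
        Finset.prod_eq_one fun j _ => by simp only [hb, hall _, if_true]
      rw [h1, one_mul, hθb, hk₀]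
      exact h _ (e k₀).2 _ (e (Fin.last m)).2 (hall k₀) (hall _)
    · push Not at hall
      obtain ⟨k, hk⟩ := hall
      have hle : Finset.univ.inf' Finset.univ_nonempty (fun k => X.slotValue i (e k).1) ≤ 0 :=
        (Finset.inf'_le _ (Finset.mem_univ k)).trans (X.slotValue_eq_zero_of_not_mem i hk).le
      have hge : 0 ≤ Finset.univ.inf' Finset.univ_nonempty (fun k => X.slotValue i (e k).1) := by
        rw [hk₀]; exact X.zero_le_slotValue' i (e k₀).1
      have hzero : (∏ j : Fin m, b (e (Fin.castSucc j))) * (b (e (Fin.last m)) * θ (e (Fin.last m))) = 0 := by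
        rcases Fin.eq_castSucc_or_eq_last k with ⟨j, rfl⟩ | rfl
        · rw [Finset.prod_eq_zero (Finset.mem_univ j) (by simp only [hb, hk, if_false]), zero_mul]
        · simp only [hb, hk, if_false, zero_mul, mul_zero]
      rw [hzero]
      exact le_antisymm hle hge
  have hA : ∑ e : Fin (m + 1) → placesOver F p, θ (e (Fin.last m)) * ∏ k, w (e k) =
      ∑ v : placesOver F p, X.slotValue i v.1 * weight F v.1 :=
    sum_last_mul_prod_weight w (sum_weight_placesOver p) θ
  have hB : ∑ e : Fin (m + 1) → placesOver F p,
      ((∏ j : Fin m, b (e (Fin.castSucc j))) * (b (e (Fin.last m)) * θ (e (Fin.last m)))) * ∏ k, w (e k) =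
      (∑ v ∈ Finset.univ.filter (fun v : placesOver F p => v.1 ∈ X.S), weight F v.1) ^ m *
        ∑ v : placesOver F p, X.slotValue i v.1 * weight F v.1 := by
    rw [sum_prodInit_mul_last_mul_prod_weight w b (fun v => b v * θ v), X.badWeight_eq_sum_indicator p]
    congr 1
    exact Finset.sum_congr rfl fun v _ => by rw [hθb, mul_comm]
  calc ∑ e : Fin (m + 1) → placesOver F p,
        (X.slotValue i (e (Fin.last _)).1
          - Finset.univ.inf' Finset.univ_nonempty (fun k => X.slotValue i (e k).1)) * ∏ k, weight F (e k).1
      = ∑ e : Fin (m + 1) → placesOver F p,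
          (θ (e (Fin.last m)) * ∏ k, w (e k)
            - ((∏ j : Fin m, b (e (Fin.castSucc j))) * (b (e (Fin.last m)) * θ (e (Fin.last m)))) *
                ∏ k, w (e k)) := by
        refine Finset.sum_congr rfl fun e _ => ?_
        rw [hinf e, sub_mul]
    _ = (∑ e : Fin (m + 1) → placesOver F p, θ (e (Fin.last m)) * ∏ k, w (e k))
          - ∑ e : Fin (m + 1) → placesOver F p,
              ((∏ j : Fin m, b (e (Fin.castSucc j))) * (b (e (Fin.last m)) * θ (e (Fin.last m)))) *
                ∏ k, w (e k) := Finset.sum_sub_distrib _ _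
    _ = _ := by rw [hA, hB]; ring

open scoped Classical in
/-- **Exact residue at a prime whose bad places `θ` does not distinguish** (every `θ_j` constant on `V(F)_p ∩ S`):
`slotResidue X {p} = (1/ℓ⋇)·Σ_j (1 − ω_b(p)^j)·a_j(p)` — part I's sharp lower bound is attained.
[cite: Mochizuki2012, IUTchIV Thm. 1.10 Step (v) p. 27–28] -/
theorem slotResidue_singleton_eq_of_badConst (p : ℕ) [Fact p.Prime]
    (h : ∀ (i : Fin X.lstar), ∀ v ∈ placesOver F p, ∀ v' ∈ placesOver F p, v ∈ X.S → v' ∈ X.S →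
      X.slotValue i v = X.slotValue i v') :
    X.slotResidue {p} = (1 / (X.lstar : ℝ)) * ∑ i : Fin X.lstar,
      (1 - (∑ v ∈ Finset.univ.filter (fun v : placesOver F p => v.1 ∈ X.S), weight F v.1) ^ ((i : ℕ) + 1)) *
        ∑ v : placesOver F p, X.slotValue i v.1 * weight F v.1 := by
  rw [slotResidue_singleton_eq_sum]
  congr 1
  exact Finset.sum_congr rfl fun i _ => X.inner_defect_sum_eq_of_badConst p i (h i)

open scoped Classical in
/-- **Exactly one bad place `v` over `p`**: `slotResidue X {p} = (1/ℓ⋇)·Σ_j (1 − Pr(v)^j)·j²·μ(v)·Pr(v)` with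
`μ(v) = P_q(v)·ln|κ(v)|/n_v` — e.g. a prime of `F_mod` split into a bad and a good place of a quadratic field.
[cite: Mochizuki2012, IUTchIV Thm. 1.10 Step (v) p. 27–28] -/
theorem slotResidue_singleton_eq_of_unique_bad (p : ℕ) [Fact p.Prime] {v : HeightOneSpectrum (𝓞 F)}
    (hv : v ∈ placesOver F p) (hvS : v ∈ X.S) (huniq : ∀ v' ∈ placesOver F p, v' ∈ X.S → v' = v) :
    X.slotResidue {p} = (1 / (X.lstar : ℝ)) * ∑ i : Fin X.lstar,
      (1 - weight F v ^ ((i : ℕ) + 1)) *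
        ((((i : ℕ) + 1 : ℝ) ^ 2) * (X.qPilot v * logNorm F v / (localDegree F v : ℝ)) * weight F v) := by
  classical
  have hconst : ∀ (i : Fin X.lstar), ∀ u ∈ placesOver F p, ∀ u' ∈ placesOver F p, u ∈ X.S → u' ∈ X.S →
      X.slotValue i u = X.slotValue i u' := by
    intro i u hu u' hu' huS hu'S
    rw [huniq u hu huS, huniq u' hu' hu'S]
  rw [X.slotResidue_singleton_eq_of_badConst p hconst]
  have hωb : ∑ u ∈ Finset.univ.filter (fun u : placesOver F p => u.1 ∈ X.S), weight F u.1 = weight F v := by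
    have hfilter : Finset.univ.filter (fun u : placesOver F p => u.1 ∈ X.S) = {⟨v, hv⟩} := by
      ext u
      simp only [Finset.mem_filter, Finset.mem_univ, true_and, Finset.mem_singleton]
      constructor
      · intro huS; exact Subtype.ext (huniq u.1 u.2 huS)
      · rintro rfl; exact hvS
    rw [hfilter, Finset.sum_singleton]
  have ha : ∀ i : Fin X.lstar, ∑ u : placesOver F p, X.slotValue i u.1 * weight F u.1 =
      (((i : ℕ) + 1 : ℝ) ^ 2) * (X.qPilot v * logNorm F v / (localDegree F v : ℝ)) * weight F v := by
    intro i
    rw [Finset.sum_eq_single (⟨v, hv⟩ : placesOver F p) (fun u _ hu => ?_) (fun hn => absurd (Finset.mem_univ _) hn),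
      slotValue_eq_sq_mul]
    have huS : u.1 ∉ X.S := fun huS => hu (Subtype.ext (huniq u.1 u.2 huS))
    rw [X.slotValue_eq_zero_of_not_mem i huS, zero_mul]
  simp only [hωb, ha]

open scoped Classical in
/-- Part I's sharp bound dominates w6-d018's good-share bound termwise: `ω_g(p)·a_j(p) ≤ (1 − ω_b(p)^j)·a_j(p)` (`ω_b^j ≤ ω_b`,
`ω_g = 1 − ω_b`, `a_j ≥ 0`). [cite: DupuyHilado2025, §3.6] -/
theorem goodWeight_mul_le_sharp_term (p : ℕ) [Fact p.Prime] (i : Fin X.lstar) :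
    (∑ v ∈ Finset.univ.filter (fun v : placesOver F p => v.1 ∉ X.S), weight F v.1) *
        ∑ v : placesOver F p, X.slotValue i v.1 * weight F v.1 ≤
      (1 - (∑ v ∈ Finset.univ.filter (fun v : placesOver F p => v.1 ∈ X.S), weight F v.1) ^ ((i : ℕ) + 1)) *
        ∑ v : placesOver F p, X.slotValue i v.1 * weight F v.1 := by
  rw [X.goodWeight_eq_one_sub_badWeight p]
  have hpow : (∑ v ∈ Finset.univ.filter (fun v : placesOver F p => v.1 ∈ X.S), weight F v.1) ^ ((i : ℕ) + 1) ≤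
      ∑ v ∈ Finset.univ.filter (fun v : placesOver F p => v.1 ∈ X.S), weight F v.1 :=
    pow_le_of_le_one (X.badWeight_nonneg p) (X.badWeight_le_one p) (Nat.succ_ne_zero _)
  exact mul_le_mul_of_nonneg_right (by linarith) (X.sum_slotValue_mul_weight_nonneg p i)

end PilotData

end Literature.IUT.LogVolume

end
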